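import Literature.Topology.FourManifolds.TautFoliationsCollarLevels
import Literature.Topology.FourManifolds.TautFoliationsGermCovering
import HarnessLib

/-!
# Functions which are locally homeomorphism germs of a piecewise monotone function are tame

Sibling of `TautFoliationsCollarLevels.lean`. If `f` agrees, near every point of `[0, len]`
(within `[0, len]`), with `χ ∘ τ` for a homeomorphism germ `χ` at `τ u` (depending on the
point), where `τ` is continuous with a piece shape (constant and strictly monotone pieces), and
`f` is continuous on `[0, len]`, then `f` is tame on `[0, len]`. This is the abstract form of the
tameness of the heights of the coned fence collar along the outer-collar grid edges
(`τ` = the level along the edge, `χ` = the local height germ of the fence in the box).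

* `isTameOn_of_local_germ` (**proved**).

All statements are [folklore].
-/

noncomputable section

open Set Filter Function
open scoped Topology

namespace Literature.Topology.FourManifolds

namespace CollarRadius

open TameFunction Foliation

/-- **Tameness from local homeomorphism germs of a piecewise monotone function.** [folklore] -/
theorem isTameOn_of_local_germ {f τ : ℝ → ℝ} {len : ℝ} (hfc : ContinuousOn f (Icc 0 len))
    (hτc : ContinuousOn τ (Icc 0 len)) (hshape : PieceShape τ len)
    (hloc : ∀ u ∈ Icc 0 len, ∃ χ : ℝ → ℝ, IsHomeoGermAt χ (τ u) ∧ ∀ᶠ v in 𝓝[Icc 0 len] u, f v = χ (τ v)) :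
    IsTameOn f 0 len := by
  have hτt : IsTameOn τ 0 len := hshape.isTameOn hτc
  refine ⟨hfc, fun u hu ↦ ?_, fun u hu ↦ ?_⟩
  · -- right tameness at `u ∈ [0, len)`
    obtain ⟨χ, ⟨κ, hκ, -, hmono⟩, hev⟩ := hloc u ⟨hu.1, hu.2.le⟩
    have hτr : IsTameRight τ u := hτt.2.1 u hu
    have hcw : ContinuousWithinAt τ (Ici u) u := by
      have h1 : ContinuousWithinAt τ (Icc 0 len) u := hτc u ⟨hu.1, hu.2.le⟩
      have h2 : Icc 0 len ∈ 𝓝[Ici u] u := by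
        rw [mem_nhdsWithin]
        exact ⟨Iio len, isOpen_Iio, hu.2, fun v hv ↦ ⟨hu.1.trans hv.2, hv.1.le⟩⟩
      exact (h1.mono_of_mem_nhdsWithin h2)
    have hs : Ioo (τ u - κ) (τ u + κ) ∈ 𝓝 (τ u) := Ioo_mem_nhds (by linarith) (by linarith)
    have hcomp : IsTameRight (χ ∘ τ) u := by
      rcases hmono with hm | hm
      · exact hτr.comp_of_strictMonoOn hcw hs hm
      · exact hτr.comp_of_strictAntiOn hcw hs hm
    -- `f = χ ∘ τ` on a right neighbourhood within `[0, len]`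
    obtain ⟨O, hO, hOsub⟩ : ∃ O ∈ 𝓝 u, ∀ v ∈ O ∩ Icc 0 len, f v = χ (τ v) := by
      obtain ⟨O, hO, h⟩ := mem_nhdsWithin_iff_exists_mem_nhds_inter.1 hev
      exact ⟨O, hO, fun v hv ↦ h hv⟩
    obtain ⟨δ, hδ, hδO⟩ := Metric.mem_nhds_iff.1 hO
    set δ₁ := min (δ / 2) (len - u) with hδ₁
    have hδ₁pos : 0 < δ₁ := lt_min (by linarith) (by linarith [hu.2])
    refine hcomp.congr hδ₁pos fun v hv ↦ ?_
    refine (hOsub v ⟨hδO ?_, ⟨hu.1.trans hv.1, ?_⟩⟩).symm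
    · rw [Metric.mem_ball, Real.dist_eq, abs_lt]
      have h1 := min_le_left (δ / 2) (len - u)
      constructor <;> linarith [hv.1, hv.2]
    · have h1 := min_le_right (δ / 2) (len - u); linarith [hv.2]
  · -- left tameness at `u ∈ (0, len]`
    obtain ⟨χ, ⟨κ, hκ, -, hmono⟩, hev⟩ := hloc u ⟨hu.1.le, hu.2⟩
    have hτl : IsTameLeft τ u := hτt.2.2 u hu
    have hcw : ContinuousWithinAt τ (Iic u) u := by
      have h1 : ContinuousWithinAt τ (Icc 0 len) u := hτc u ⟨hu.1.le, hu.2⟩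
      have h2 : Icc 0 len ∈ 𝓝[Iic u] u := by
        rw [mem_nhdsWithin]
        exact ⟨Ioi 0, isOpen_Ioi, hu.1, fun v hv ↦ ⟨hv.1.le, hv.2.trans hu.2⟩⟩
      exact (h1.mono_of_mem_nhdsWithin h2)
    have hs : Ioo (τ u - κ) (τ u + κ) ∈ 𝓝 (τ u) := Ioo_mem_nhds (by linarith) (by linarith)
    have hcomp : IsTameLeft (χ ∘ τ) u := by
      rcases hmono with hm | hm
      · exact hτl.comp_of_strictMonoOn hcw hs hm
      · exact hτl.comp_of_strictAntiOn hcw hs hm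
    obtain ⟨O, hO, hOsub⟩ : ∃ O ∈ 𝓝 u, ∀ v ∈ O ∩ Icc 0 len, f v = χ (τ v) := by
      obtain ⟨O, hO, h⟩ := mem_nhdsWithin_iff_exists_mem_nhds_inter.1 hev
      exact ⟨O, hO, fun v hv ↦ h hv⟩
    obtain ⟨δ, hδ, hδO⟩ := Metric.mem_nhds_iff.1 hO
    set δ₁ := min (δ / 2) u with hδ₁
    have hδ₁pos : 0 < δ₁ := lt_min (by linarith) hu.1
    refine hcomp.congr hδ₁pos fun v hv ↦ ?_
    refine (hOsub v ⟨hδO ?_, ⟨?_, hv.2.trans hu.2⟩⟩).symm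
    · rw [Metric.mem_ball, Real.dist_eq, abs_lt]
      have h1 := min_le_left (δ / 2) u
      constructor <;> linarith [hv.1, hv.2]
    · have h1 := min_le_right (δ / 2) u; linarith [hv.1]

end CollarRadius

end Literature.Topology.FourManifolds
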